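import Literature.AlgebraicGeometry.Resolution.LocalBlowup
import Mathlib.Algebra.Field.Subfield.Basic
import HarnessLib

/-!
# Fractions of invariants: `Frac(T)^σ = Frac(T^σ)` for an automorphism of finite order

Topic: `Literature/AlgebraicGeometry/Resolution`. PROOF side of `CossartPiltant2019ReductionP`
(`ArithmeticalThreefoldsLocal.lean`), input (C4), toric route, model currency
(`TameCyclicToricDescentModels.lean`): the conclusion of `hC4` asks that the field downstairs be
generated by the model (`M ≤ Subfield.closure (S ∪ t)`); for the model `S[t₀]^σ = S[g]` of
invariants this is the classical fact that a `σ`-fixed fraction `a/b` of elements of a `σ`-stable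
subring `T` is a fraction of `σ`-FIXED elements of `T` — multiply numerator and denominator by
the conjugates `σ b ⋯ σ^{ℓ-1} b` ([CoP1] proof of Lemma 9.4: "`R := S^G`. Then `R` is a normal
local model of `V/k`", in particular `QF(R) = K = L^G`; the same norm trick as
`TameCyclicFixedModel.locAtCentre_inf_fixedSubring_eq`).

* `mem_subfieldClosure_fixed_of_apply_eq` — PROVED.

Everything is PROVED; no named facts are introduced.

## Sources

* V. Cossart, O. Piltant, *Resolution of singularities of threefolds in positive characteristic.
  I*, J. Algebra 320 (2008) 1051–1082: proof of Lemma 9.4 (HAL hal-00139124, pp. 28–29).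
  [CossartPiltant2008]
-/

noncomputable section

namespace Literature.AlgebraicGeometry.Resolution

universe u

variable {F : Type u} [Field F]

/-- **Fixed fractions are fractions of fixed elements** ([CoP1] proof of Lemma 9.4: the ring
of invariants `R = S^G` of a model `S` of `L` is a model of `K = L^G`, "`QF(R) = K`"). Let `σ`
be an automorphism of the field `F` with `σ^ℓ = 1` (`ℓ ≠ 0`) and `T ⊆ F` a `σ`-stable subring.
Then every `σ`-fixed element of the subfield generated by `T` lies in the subfield generated by
the `σ`-fixed elements of `T`: for `z = a/b`, `z = (a ∏_{0<i<ℓ} σⁱb) / ∏_{i<ℓ} σⁱb` with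
numerator and denominator fixed. [cite: CossartPiltant2008, proof of Lemma 9.4 (HAL pp. 28–29), "R is a normal local model of V"] -/
theorem mem_subfieldClosure_fixed_of_apply_eq (σ : F ≃+* F) {ℓ : ℕ} (hℓ0 : ℓ ≠ 0)
    (hσℓ : σ ^ ℓ = 1) (T : Subring F) (hT : ∀ x ∈ T, σ x ∈ T) {z : F}
    (hz : z ∈ Subfield.closure (T : Set F)) (hσz : σ z = z) :
    z ∈ Subfield.closure ({x : F | x ∈ T ∧ σ x = x}) := by
  classical
  have hℓpos : 0 < ℓ := Nat.pos_of_ne_zero hℓ0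
  -- powers of `σ` preserve `T`
  have hTpow : ∀ (i : ℕ) (x : F), x ∈ T → (σ ^ i) x ∈ T := by
    intro i
    induction i with
    | zero => intro x hx; exact hx
    | succ i ih => intro x hx; rw [pow_succ', RingAut.mul_apply]; exact hT _ (ih x hx)
  -- the norm `N b = ∏_{i<ℓ} σⁱ b` is fixed
  have hnorm : ∀ b : F, σ (∏ i ∈ Finset.range ℓ, (σ ^ i) b) = ∏ i ∈ Finset.range ℓ, (σ ^ i) b := by
    intro b
    rw [map_prod]
    let f : ℕ → F := fun i => (σ ^ i) b
    have hf : ∀ i, σ ((σ ^ i) b) = f (i + 1) := fun i => by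
      change σ ((σ ^ i) b) = (σ ^ (i + 1)) b
      rw [pow_succ', RingAut.mul_apply]
    simp only [hf]
    have hfℓ : f ℓ = f 0 := by
      change (σ ^ ℓ) b = (σ ^ 0) b
      rw [hσℓ, pow_zero]
    obtain ⟨m, hm⟩ : ∃ m, ℓ = m + 1 := ⟨ℓ - 1, by omega⟩
    rw [hm, Finset.prod_range_succ' f, Finset.prod_range_succ (fun i => f (i + 1)), ← hm, hfℓ]
  -- write `z = a / b` with `a, b ∈ T`
  rw [Subfield.mem_closure_iff] at hz
  obtain ⟨a, ha, b, hb, rfl⟩ := hz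
  rw [Subring.closure_eq] at ha hb
  set Tσ : Set F := {x : F | x ∈ T ∧ σ x = x} with hTσ
  by_cases hb0 : b = 0
  · rw [hb0, div_zero]; exact (Subfield.closure Tσ).zero_mem
  -- the norm of `b` and the adjusted numerator
  set N : F := ∏ i ∈ Finset.range ℓ, (σ ^ i) b with hN
  have hNT : N ∈ T := T.prod_mem fun i _ => hTpow i b hb
  have hN0 : N ≠ 0 := Finset.prod_ne_zero_iff.mpr fun i _ => by
    change (σ ^ i) b ≠ 0
    exact (map_ne_zero_iff _ (σ ^ i).injective).mpr hb0
  have hNfix : σ N = N := hnorm b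
  -- `N = b * N'` with `N' = ∏_{0<i<ℓ} σⁱ b ∈ T`
  set N' : F := ∏ i ∈ Finset.range (ℓ - 1), (σ ^ (i + 1)) b with hN'
  have hN'T : N' ∈ T := T.prod_mem fun i _ => hTpow (i + 1) b hb
  have hNN' : N = N' * b := by
    rw [hN, hN']
    conv_lhs => rw [show ℓ = (ℓ - 1) + 1 by omega, Finset.prod_range_succ' (fun i => (σ ^ i) b)]
    simp
  have hN'0 : N' ≠ 0 := Finset.prod_ne_zero_iff.mpr fun i _ =>
    (map_ne_zero_iff _ (σ ^ (i + 1)).injective).mpr hb0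
  -- `a / b = (a N') / N`, a fraction of fixed elements of `T`
  have hkey : a / b = (a * N') / N := by
    rw [hNN', eq_div_iff (mul_ne_zero hN'0 hb0)]
    field_simp
  have hnumfix : σ (a * N') = a * N' := by
    -- `a N' = (a/b) · N` is fixed since `a/b` and `N` are
    have h1 : a * N' = (a / b) * N := by rw [hNN']; field_simp
    rw [h1, map_mul, hσz, hNfix]
  rw [hkey]
  exact div_mem (Subfield.subset_closure ⟨T.mul_mem ha hN'T, hnumfix⟩)
    (Subfield.subset_closure ⟨hNT, hNfix⟩)

end Literature.AlgebraicGeometry.Resolution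

end
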